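import Mathlib
import HarnessLib
import HarnessLib.Audit
import Summits.CriticalPhenomena.Statement
import Literature.Probability.RandomPlanarGeometry.SLEConvergenceCriterion
import Literature.Probability.RandomPlanarGeometry.ConformalRectangle
import Literature.Probability.RandomPlanarGeometry.ObservableDrivingMartingales
import Literature.Probability.LatticeModels.SRWPathSpace
import HarnessLib.Audit.Status.Attr

/-!
Route: SAWStressTensor

DORMANT since 2026-08-26T04:22:06Z (reconciler: no traction for 8.3 d (last activity item-evidence-added at 2026-08-17T19:24:59Z); parked, not closed — `ledger route dormant route-CriticalPhenomena-SAWStressTensor --off` to reactivate) — unstaffed, not closed; items shared with open routes are served there. `ledger route dormant <id> --off` reactivates.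

# Route SAWStressTensor — no walk, no anomaly — the c = 0 lattice stress tensor (D4 occupation
quadrupole) is an amplitude-free martingale observable whose pure weight-2 shape pins κ = 8/3

It suffices to show X_T = (Q) ∧ (S) ∧ (T), processed by the identification theorem (I) [route
realising idea card
c0-stress-tensor-amplitude-free — "no walk, no anomaly"]:
 (Q) SlitQuadrupoleShape — THE LATTICE STRESS TENSOR HAS THE PURE WEIGHT-2 SHAPE. Observable: the
two D4 quadrupoles of the
occupation pattern of the critical square-lattice SAW γ (law
Literature.Probability.RandomPlanarGeometry.SAW.law, weight x_c^|γ|) at an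
interior vertex z: X₁ = 1{γ passes straight through z horizontally} − 1{… vertically} (channel B1 ~
T_xx − T_yy) and X₂ = 1{γ turns NE or SW
at z} − 1{γ turns NW or SE at z} (channel B2 ~ T_xy). Claim: there are amplitudes A₁(δ), A₂(δ)
depending on the mesh ONLY (possibly carrying
log δ) such that, conditionally on any initial segment η of γ (tip v) and uniformly over prefixes,
E[X₁(z) | η]/A₁(δ) = Re S_η(z) + o(1) and
E[X₂(z) | η]/A₂(δ) = Im S_η(z) + o(1) for z in the bulk ρ-away from η, where S_η is the h-FREE
one-point shape of the holomorphic stress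
tensor of the slit domain, written on the lattice as the square of the discrete ∂_z log of a ratio
of two killed-random-walk Green
functions (poles at b_δ and at the tip; every local lattice factor and every normalisation cancels
under ∂ log):
S_D(z) = (ψ′(z)/ψ(z))² for ψ : Ω → ℍ, ψ(a) = 0, ψ(b) = ∞ — Doyon–Riva–Cardy's ⟨T(w)⟩ = h/w² with the
weight h DIVIDED OUT. Its prefix-free
case is the headline crux QuadrupoleShape (conformal-map form, below).
 (S) SimpleSubseqLimits — subsequential weak limits of the SAW laws are carried by simple chords
(shared item stmt-CriticalPhenomena-4514).
 (T) EventualTight — eventual tightness (shared item stmt-CriticalPhenomena-1881; NOT the refuted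
all-δ stmt-CriticalPhenomena-0772).
 (I) QuadrupoleIdentification := SlitQuadrupoleShape → SimpleSubseqLimits → SubseqIdentification:
for a subsequential limit μ,
Loewner-parametrise, note that n ↦ E[X_i(z) | γ[0,n]] is an EXACT bounded lattice martingale (domain
Markov of x_c^|γ|), so by (Q) the
complex process ψ′(z)² g_t′(w)²/(g_t(w) − W_t)², w = ψ(z), is a μ-martingale for every bulk z; its
far-field expansion at w = iy,
(iy·g′/(g − W))² = 1 + 2W/(iy) + (3W² − 8t)/(iy)² + O(y⁻³), makes W_t and W_t² − (8/3)t martingales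
(support item TMartingaleDriver,
provable now: the FK proof of the tree with 16/3 ↦ 8/3) — NO exponent (5/8, 5/48, 2/3) is ever
input, the amplitude h cancels — and the
tree's PROVED isSLELaw_of_isLocalMartingale_driving_of_lt_four (κ = 8/3 < 4) gives IsSLELaw (8/3).
Then (T) and the PROVED Prokhorov
criterion convergesInLawToSLE_of_isTightAlongMesh give SAWScalingLimit. No unproved Literature fact
sits in the assembly cone.
Lean: `∃ A₁ A₂ : ℝ → ℝ, ∀ (D : Literature.Probability.RandomPlanarGeometry.DobrushinDomain) (a b z :
ℝ → Literature.Probability.LatticeModels.Site 2) (z₀ : ℂ) (φ :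
Literature.Probability.RandomPlanarGeometry.ConformalEquiv UpperHalfPlane.upperHalfPlaneSet
D.carrier), let X₁ : (δ : ℝ) → Literature.Probability.LatticeModels.Site 2 →
Literature.Probability.RandomPlanarGeometry.SAW.DomainSAW D.carrier δ (a δ) (b δ) → ℝ := fun _ v γ
=> (if s(v - ![1, 0], v) ∈ γ.walk.edges ∧ s(v, v + ![1, 0]) ∈ γ.walk.edges then (1 : ℝ) else 0) -
(if s(v - ![0, 1], v) ∈ γ.walk.edges ∧ s(v, v + ![0, 1]) ∈ γ.walk.edges then (1 : ℝ) else 0); let X₂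
: (δ : ℝ) → Literature.Probability.LatticeModels.Site 2 →
Literature.Probability.RandomPlanarGeometry.SAW.DomainSAW D.carrier δ (a δ) (b δ) → ℝ := fun _ v γ
=> (if (s(v, v + ![1, 0]) ∈ γ.walk.edges ∧ s(v, v + ![0, 1]) ∈ γ.walk.edges) ∨ (s(v - ![1, 0], v) ∈
γ.walk.edges ∧ s(v - ![0, 1], v) ∈ γ.walk.edges) then (1 : ℝ) else 0) - (if (s(v - ![1, 0], v) ∈
γ.walk.edges ∧ s(v, v + ![0, 1]) ∈ γ.walk.edges) ∨ (s(v, v + ![1, 0]) ∈ γ.walk.edges ∧ s(v - ![0,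
1], v) ∈ γ.walk.edges) then (1 : ℝ) else 0);
Literature.Probability.RandomPlanarGeometry.SAW.IsEndpointApprox D a b → D.IsChordalUniformizing φ →
z₀ ∈ D.carrier → Filter.Tendsto (fun δ => Literature.Probability.LatticeModels.meshPoint δ (z δ))
(nhdsWithin 0 (Set.Ioi 0)) (nhds z₀) → Filter.Tendsto (fun δ => (∫ γ, X₁ δ (z δ) γ
∂(Literature.Probability.RandomPlanarGeometry.SAW.law D.carrier δ (a δ) (b δ))) / A₁ δ) (nhdsWithin
0 (Set.Ioi 0)) (nhds ((deriv φ.symm z₀) ^ 2 / (φ.symm z₀) ^ 2).re) ∧ Filter.Tendsto (fun δ => (∫ γ,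
X₂ δ (z δ) γ ∂(Literature.Probability.RandomPlanarGeometry.SAW.law D.carrier δ (a δ) (b δ))) / A₂ δ)
(nhdsWithin 0 (Set.Ioi 0)) (nhds ((deriv φ.symm z₀) ^ 2 / (φ.symm z₀) ^ 2).im)`
(the headline crux QuadrupoleShape; X_T itself is SlitQuadrupoleShape ∧ SimpleSubseqLimits ∧
EventualTight, and Assembly := QuadrupoleShape →
SlitQuadrupoleShape → SimpleSubseqLimits → QuadrupoleIdentification → EventualTight →
SAWScalingLimit; every decl elaborates, planner
Sketch.lean rc = 0, and `QuadrupoleIdentification = (SlitQuadrupoleShape → SimpleSubseqLimits →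
SubseqIdentification)` is rfl there)

## Assembly
QuadrupoleIdentification applied to SlitQuadrupoleShape and SimpleSubseqLimits yields
SubseqIdentification (its inlined hypotheses and
conclusion are rfl-equal to the decls); for each (D, a, b) with IsEndpointApprox the SAW laws are
probability measures for all small δ
(IsEndpointApprox.reachable ⇒ weight univ ≠ 0; finitely many SAWs in bounded Ω_δ ⇒ < ∞), so replace
SAW.law by a family of probability
measures agreeing with it eventually (ConvergesInLawToSLE, IsTightAlongMesh and the
subsequential-limit hypothesis only see the germ at
0+), apply the PROVED
Literature.Probability.RandomPlanarGeometry.convergesInLawToSLE_of_isTightAlongMesh with huniq :=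
IsSLECurve.map_eq_holds, hY := eventually SAW.aemeasurable_curve, hT := EventualTight, hL :=
SubseqIdentification read through
IsSubseqLimitLaw, and unfold SAWScalingLimit. QuadrupoleShape is carried as the (η = nil) headline
hypothesis. Same logical shape as the
accepted assembly stmt-CriticalPhenomena-5565 of route SAWExcursionCardy.

Rationale: WHY THIS LINE. Every proved interface ⇒ SLE theorem runs a discrete observable with a conformally
covariant limit through the martingale principle
(Smirnov2007ICM §5; CDHKSCRAS2014 §3; DuminilCopinSmirnov2012Clay Prop. 6.7); for the SAW the only
candidate in print is the spin-5/8
parafermion (DuminilCopinSmirnov2012 Conj. 2, route SAWParafermion), which needs a boundary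
normalisation carrying lattice factors
(KennedyLawler2013) and an irrational exponent as input. This line takes instead the STRESS TENSOR:
at c = 0 it is anomaly-free, so its
chordal one-point function is the pure quadratic differential h(ψ′/ψ)² (DoyonRivaCardy2006 Thm 2.1
with k = l = 0: the spin-2 mode of
SLE(8/3)/restriction hitting probabilities obeys the c = 0 Ward identity, Q₂(w) = h/w²;
FriedrichWerner2003 on the boundary), and the
CONVERSE is an identification theorem in which h cancels: (z g′/(g − W))^α is an SLE_κ martingale
iff κ = 8/(α+1) (α = 1/2 is the FK
observable of the tree, κ = 16/3; α = 2 is T, κ = 8/3) — BauerBernard2003's level-2 Virasoro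
martingale read backwards. The lattice side
is Kadanoff–Ceva's dictionary (Cardy2013: energy = occupation at n → 0; T_xx − T_yy and T_xy are the
two D4 quadrupole channels), a
probability of LOCAL events under the normalised law, so endpoint lattice factors cancel and no
partition function is normalised;
universality of the amplitude across domains is locality of operator renormalisation, the statement
BenesLawlerViklund2015 proved for
the LERW vertex Green's function (P(z ∈ LERW) = c_latt δ^{3/4}[G_D(z) + o(1)]). Imported areas: c =
0 (logarithmic) CFT / conformal
restriction (DRC, FW, GurarieLudwig2005, arXiv:1110.1327), Loewner far-field martingale
identification (CDHKS, all in the tree), discrete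
potential theory (KozdronLawler2005-type Green-function ratios). What it adds to prior routes and
the negatives index: a new observable
class (spin 2, amplitude-free, no 5/8 input, both D4 channels so the identification survives any
boundary geometry at b), an honest
flag of the c = 0 log-partner t = Φ_{2,1} (dimension exactly 2 at g = 3/2) inside the crux, and no
use of the refuted all-δ tightness.
The sibling card quadrupole-ward-two-bodies uses the SAME two densities (axis quadrupole, corner
chirality) as a covariance RESPONSE field
with arbitrary insertions (local Ward ⇒ conformal covariance ⇒ restriction routes); this route needs
only their ONE-point functions and
closes by the martingale principle, so the two are complementary, not rival decompositions.

RANKED CRUXES. #2 QuadrupoleShape (crux) — (card K1, prefix-free headline) there are amplitudes A₁,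
A₂ : ℝ → ℝ depending only on the mesh such that for every Dobrushin domain (Ω; a, b), endpoint
approximation, interior point z₀ with lattice points z_δ → z₀, and chordal uniformizer φ : ℍ → Ω (0
↦ a, ∞ ↦ b; ψ = φ⁻¹): E_δ[X₁(z_δ)]/A₁(δ) → Re (ψ′(z₀)/ψ(z₀))² and E_δ[X₂(z_δ)]/A₂(δ) → Im
(ψ′(z₀)/ψ(z₀))², X₁ = straight-horizontal minus straight-vertical passage at z, X₂ = (NE or SW turn)
minus (NW or SE turn) at z; the shape is invariant under ψ ↦ λψ, so nothing is normalised and no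
exponent enters. [difficulty: open-problem] (why it might fail: Conformal covariance of a spin-2
one-point function with no ℤ² lattice engine; the quadrupole couples to the c=0 log partner
t=Φ_{2,1} (x=2 exactly), so D-dependent corrections decay only like 1/log(1/δ); a spin-2 two-leg
operator with x<2, or a non-local amplitude, refutes it.) [DoyonRivaCardy2006, FriedrichWerner2003,
BauerBernard2003, Cardy2013, GurarieLudwig2005, arXiv:1110.1327, BenesLawlerViklund2015,
ChelkakGlazmanSmirnov2016, Literature.Barriers.CriticalPhenomena.NienhuisWeightsExcludeVertexSAW]
#3 SlitQuadrupoleShape (crux) — (card K1, martingale-ready and lattice-intrinsic) there are A₁, A₂ :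
ℝ → ℝ such that for every Dobrushin domain and endpoint approximation, every ε, ρ > 0 and all small
δ: for EVERY self-avoiding prefix η of positive SAW.law-probability from a_δ to a tip v and every
site z that is ρ-inside Ω and ρ-away from b_δ and from all vertices of η, |E[X₁(z) | γ extends
η]/A₁(δ) − Re S^δ_η(z)| ≤ ε and |E[X₂(z) | γ extends η]/A₂(δ) − Im S^δ_η(z)| ≤ ε, where S^δ_η(z) =
(D_z L)², L(p) = log(G_η(p, b_δ)/G_η(p, v)), G_η the Green function of SRW on Ω_δ minus η∖{v} killed
at its first illegal step, and D_z L = [(L(z+e₁) − L(z−e₁)) − i(L(z+e₂) − L(z−e₂))]/(4δ) the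
discrete ∂_z: the random-walk form of (ψ′_η/ψ_η)² for the slit domain (poles at the tip and at b;
constants, local lattice factors and the log-partner amplitude all cancel under ∂ log). η = nil
recovers QuadrupoleShape once the RW shape converges to the conformal one. [deps: QuadrupoleShape]
[difficulty: open-problem] (why it might fail: Uniformity over ALL rough lattice slits with ONE
amplitude is a local-limit statement beyond the scaling limit (proved only for LERW, BLV); an
interior a_δ makes Ω_δ∖η doubly connected at scale dist(a_δ,∂Ω); lattice-scale necks cut by the past
may leave O(1) gaps vanishing only in probability.) [BenesLawlerViklund2015, KozdronLawler2005,
KennedyLawler2013, DoyonRivaCardy2006, LawlerSchrammWerner2004SAW, DuminilCopinSmirnov2012Clay]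
#4 QuadrupoleIdentification (crux) — (card K3 + the passage) QuadrupoleIdentification =
SlitQuadrupoleShape → SimpleSubseqLimits → SubseqIdentification (the two decls after the first are
INLINED verbatim — they are rendered later in the file; rfl-equal to the named form, checked in the
planner sketch). Proof plan = the CDHKS pipeline for THIS observable: (i) a subsequential limit μ
carried by simple chords is Loewner-parametrised through a chordal uniformizer φ with continuous
driving process W, W^δ → W along the SAW; (ii) the exact bounded lattice martingales n ↦ E[X_i(z) |
γ[0,n]] (domain Markov of x_c^|γ|), normalised by A_i(δ) and stopped when the walk comes ρ-close to
z, plus SlitQuadrupoleShape plus convergence of killed-RW Green-function log-gradients in slit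
domains (KozdronLawler2005-type, uniform) make Re and Im of ψ′(z)² g_t′(ψz)²/(g_t(ψz) − W_t)²
μ-martingales for every bulk z, hence (both channels!) the complex process itself; (iii) bulk z near
b ⇒ w = ψ(z) = iy-type far field: TMartingaleDriver (support) gives W_t and W_t² − (8/3)t
martingales (needs sup|W| ∈ L³, KemppainenSmirnov2017 Prop. 3.8-type tails); (iv) Lévy + the tree's
PROVED isSLELaw_of_isLocalMartingale_driving_of_lt_four (κ = 8/3 < 4) ⇒ IsSLELaw (8/3) D μ. [deps:
SlitQuadrupoleShape, SimpleSubseqLimits, TMartingaleDriver] [difficulty: L] (why it might fail: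
E[X_z|γ[0,n]]/A(δ) is unbounded off the good event (A(δ)→0), so the passage needs stopping plus
UNIFORM killed-RW Green-gradient convergence in rough slit domains (unvendored) and L³ tails of
sup|W| from simplicity alone; an interior a_δ spoils the chordal picture near t=0.) [CDHKSCRAS2014,
DuminilCopinSmirnov2012Clay, KemppainenSmirnov2017, KozdronLawler2005, LawlerSchrammWerner2004,
BauerBernard2003,
Literature.Probability.RandomPlanarGeometry.isSLELaw_of_isLocalMartingale_driving_of_lt_four,
Literature.Probability.RandomPlanarGeometry.Loewner.martingale_driver_of_fkObservable]
#5 SimpleSubseqLimits (crux) — (shared item stmt-CriticalPhenomena-4514, verbatim) for every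
Dobrushin domain, endpoint approximation, mesh sequence s_n → 0+ and probability measure μ on
CurveClass ℂ that is the weak limit of the SAW laws along s_n: μ-a.e. curve is simple and meets ∂Ω
only at a, b. Makes subsequential limits Loewner-parametrisable for QuadrupoleIdentification;
implied by the conjunct (SLE(8/3) is a simple chord). [difficulty: open-problem] (why it might fail:
Weak limits of simple polylines need not be simple: needs uniform no-macroscopic-self-touching and
no-boundary-crawling bounds for the x_c-SAW under EVERY endpoint approximation (interior a_δ
included); only sub-ballisticity is in print, LSW04 argue simplicity heuristically.)
[LawlerSchrammWerner2004SAW, KennedyLawler2013, DuminilCopinHammond2013,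
stmt-CriticalPhenomena-4514]
#6 EventualTight (crux) — (shared item stmt-CriticalPhenomena-1881, verbatim) EVENTUAL tightness of
the critical SAW laws: for every Dobrushin domain and endpoint approximation, IsTightAlongMesh (fun
δ γ => γ.curve) (fun δ => SAW.law D δ a_δ b_δ) — the form the Prokhorov criterion
convergesInLawToSLE_of_isTightAlongMesh consumes; the repair of the refuted all-δ Tight suggested by
the refuting theorem. [difficulty: open-problem] (why it might fail: Open for SAW: no RSW /
annulus-crossing bound at x_c (KemppainenSmirnov2017 §4 covers FKG models only); the all-δ form
stmt-CriticalPhenomena-0772 is refuted and only sub-ballisticity (DuminilCopinHammond2013) is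
unconditional.) [KemppainenSmirnov2017, DuminilCopinHammond2013,
Summit.CriticalPhenomena.SAWScalingLimit.Theorems.SAWParafermionTight_refuted,
stmt-CriticalPhenomena-1881]
#9 TMartingaleDriver (support) — (card K3, the KEY COMPUTATION made provable; continuum, no lattice)
for a real process W indexed by ℝ≥0 on a probability space, strongly adapted to a filtration 𝓕, with
continuous paths, W_0 = 0 and running supremum on each [0, t] dominated by some nonnegative M ∈ L³:
if for all large levels y the real and imaginary parts of the stopped stress-tensor observable (iy ·
g_r′(iy)/(g_r(iy) − W_r))² of the chordal Loewner chain of the path (g = Loewner.map), evaluated at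
the stopped clock r ∧ τ_y (τ_y = Loewner.farStopTime, the CDHKS far-field stopping time of the
tree), are 𝓕-martingales, then W_t and W_t² − (8/3)t are 𝓕-martingales. Proof =
Loewner.martingale_driver_of_fkObservable verbatim with the density expansion (z g′/(g − W))² = 1 +
2W/z + (3W² − 8t)/z² + O(α³) (multiply the tree's norm_spinDensity_sub_le by the expansion of g′):
Im gives W, Re gives 3W² − 8t. The amplitude-free identification: any constant multiple of the
observable gives the same conclusion, and κ = 8/3 is forced with no exponent input. [difficulty:
provable-now]
[Literature.Probability.RandomPlanarGeometry.Loewner.martingale_driver_of_fkObservable,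
Literature.Probability.RandomPlanarGeometry.Loewner.FarRegime.norm_spinDensity_sub_le,
CDHKSCRAS2014, BauerBernard2003, FriedrichWerner2003]
#9 SubseqIdentification (support) — (shared item stmt-CriticalPhenomena-0783, verbatim; the
conclusion of QuadrupoleIdentification, rendered so that the name exists in the file) every
subsequential weak limit of the critical SAW laws in (Ω_δ; a_δ, b_δ) along s_n → 0+ is the chordal
SLE(8/3) law of (Ω; a, b). [difficulty: open-problem] [LawlerSchrammWerner2004SAW,
LawlerSchrammWerner2003Restriction, stmt-CriticalPhenomena-0783]

TWO-LAYER PLAN. Foreseen glued splits once a crux closes (none filed now): QuadrupoleIdentification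
⇐ TObservablePassage (lattice martingale + RW
Green-gradient convergence in slit domains ⇒ the complex T-process is a μ-martingale for bulk z) →
FarFieldClosing (TMartingaleDriver +
L³ tails + isSLELaw_of_isLocalMartingale_driving_of_lt_four) → QuadrupoleIdentification;
SlitQuadrupoleShape ⇐ BoundaryAttachedCase
(a_δ adjacent to ∂Ω) → InteriorStartReduction → SlitQuadrupoleShape; QuadrupoleShape ⇐
LogPartnerAmplitude (the universal leading
amplitude A_i(δ) ~ δ² log(1/δ) exists: a two-point/annulus statement) → NormalisedShape →
QuadrupoleShape. A BOUNDARY variant (card K2: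
δ⁻²·P(γ visits a boundary vertex on a flat lattice-direction stretch) has the h-free
excursion-kernel shape (ψ′/ψ)² restricted to ∂Ω,
same far-field closing) is an alternative engine for the same SubseqIdentification and would be a
sibling route sharing items 4–6.

KILL CRITERIA. A subsequential SAW limit that is not SLE(8/3) (¬SubseqIdentification, e.g. an
anisotropic limit) kills the conjunct and every route.
¬QuadrupoleShape with the conjunct still open (e.g. a certified transfer-matrix / exact-enumeration
computation showing the normalised
B1 or B2 quadrupole converging to a NON-covariant shape, or scaling like δ^x with x ≠ 2 up to logs)
kills this line outright: close
`refuted:QuadrupoleShape` and record which operator the quadrupole actually couples to (negative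
knowledge for every T-based card).
¬SlitQuadrupoleShape with QuadrupoleShape alive forces a pivot to a mesoscopic (DRC slit-mode, ε → 0
after δ → 0) restatement.
SimpleSubseqLimits or EventualTight refuted ⇒ shared damage with routes
SAWExcursionCardy/SAWFrontierHomotopy/SAWLoopFugacityFlow; pivot
to the KS-G2 form. SubseqIdentification proved elsewhere (restriction routes) moots items 2–4 but
not the route's lattice theorem target.

NOT DECOMPOSED YET. The observable-limit passage inside QuadrupoleIdentification (stopping, capacity
parametrisation of lattice prefixes, uniform killed-RW
Green-gradient convergence in rough slit domains — a KozdronLawler2005/ChelkakSmirnov-toolbox input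
to be vendored when a prover asks);
the existence and form of the universal amplitudes A_i(δ) (log corrections from the c = 0 Jordan
cell) — deliberately hidden behind ∃ A;
the boundary-bump variant (card K2) and the flat-pressure / √T-integration corollaries (card (P),
(S)) — tests, not load-bearing; radial
and whole-plane versions; which of B1/B2 has the cleaner amplitude. All are layer-2 children or
sibling routes, later.

CHEAPEST FALSIFIER. Transfer-matrix / exact enumeration in lattice strips and small rectangles (kit
job, not yet run — kit compute was not in this seat's
budget): (i) FLAT PRESSURE — in an L-wide strip crossed lengthwise by the x_c-SAW the B1 profile y ↦
E[X₁(·, y)] must be asymptotically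
CONSTANT across the width away from the walls (T_strip = const under w = e^z) while the density
profile vanishes like a power at the
walls; a profile with bulk curvature surviving L → ∞ kills QuadrupoleShape at once; (ii) in an n × n
square with corner-to-corner SAW
(n ≤ 12 exact, larger by pivot-MCMC at x_c ≈ 0.37905) the sign pattern and principal axes of (E X₁,
E X₂)(z) must follow
Re/Im (ψ′/ψ)² (principal axis along the circle through a, z, b) up to one scalar per channel. Signal
is O(δ²) against O(δ^{2/3})
occupation, so exact enumeration, not sampling, is the right first tool. Literature lookup already
done: no printed lattice-T
identification for SAW (DRC/FW are continuum and forward; CGS 1604.06339 is hexagonal O(n) via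
Yang–Baxter, general n).

NUMBERS. κ = 8/3, c = (3κ−8)(6−κ)/(2κ) = 0, boundary weight = restriction exponent h = (6−κ)/(2κ) =
5/8 (never used as input; it is the
cancelled amplitude); far-field law κ = 8/(α+1) for the observable (z g′/(g−W))^α: α = 1/2 ↦ 16/3
(FK, in the tree), α = 1 ↦ 4,
α = 2 ↦ 8/3 (this route), α = 3 ↦ 2; DRC: spin-2 slit mode = (π/8) ε² T, Q₂(w) = h/w² in (ℍ; 0, ∞);
log-partner: x(Φ_{2,1}) = 2
exactly at g = 3/2, bulk b = −5 (arXiv:1110.1327); two-leg/energy x₂ = 2/3, so the quadrupole signal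
is δ^{4/3} (× log) below the
occupation density; x_c = 1/μ, μ ≈ 2.63815853. Items at open: 8 (5 cruxes, 2 support, 1 assembly).

DEFINITION REQUESTS. None: SAW.law, DomainSAW, IsEndpointApprox, ConformalEquiv,
MarkedDomain.IsChordalUniformizing, SRW.pathLaw, Loewner.map,
Loewner.farStopTime, IsTightAlongMesh, IsSLELaw all exist; the quadrupole indicators and the RW
shape are inlined `let`s. Bib entries
DoyonRivaCardy2006 and BenesLawlerViklund2015 were added to references.bib in this session (ledger
bib add).

Novelty: Searches (2026-08-15): `lit search` local/hybrid index: searchd unavailable (rc 75, 3 attempts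
11:50–12:20 UTC; OpenAlex/S2/arXiv
remotes rate-limited 429); `lit search --source zbmath`: "Doyon Riva Cardy identification of the
stress-energy tensor through
conformal restriction" (1: math-ph/0511054), "discrete stress-energy tensor loop O(n) model" (1:
1604.06339), "scaling limit of the
loop-erased random walk Green's function" (2: 1402.7345, Lawler STML 98), "stress tensor
self-avoiding walk lattice" (0), "Conformal
restriction, highest-weight representations and SLE" (3: math-ph/0301018, math/0209382, 2407.09080),
"logarithmic operators stress
tensor c=0 polymers" (1: hep-th/0409105), "puzzle of bulk CFT at c=0" (1110.1327); `lit galaxy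
search --star all` "lattice stress
tensor" (4 rows, none relevant), "stress tensor through conformal restriction" (0), "discrete
stress-energy tensor in the loop O(n)
model" (0); `lit galaxy search --star pdf --mode bm25` (12 rows: Smirnov ICM 2006, Werner
restriction notes math/0307353, Gruzberg
math-ph/0607046, Peltola SLE/CFT lectures 2024, Müller-Lohmann thesis, Dubédat math/0507276,
Saint-Aubin–Pearce–Rasmussen 0809.4806 —
all continuum SLE/CFT, none a lattice T-observable for SAW); `lit read arXiv:math-ph/0511054` pp. 6,
14 (Thm 2.1; "(π/8)ε²T"; no
Schwarzian at c = 0); the card's own audited searches (refuter novelty audit 2026-08-15T07:55Z,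
grade new-combination).
Nearest prior art found: DoyonRivaCardy2006 (arXiv:math-ph/0511054, Thm  [refs: math-ph/0511054, DoyonRivaCardy2006, FriedrichWerner2003, BauerBernard2003, ChelkakGlazmanSmirnov2016, BenesLawlerViklund2015, CDHKSCRAS2014]

Barriers (technique_class: martingale-observable stress-tensor spin-2): - technique_class: martingale-observable stress-tensor spin-2
- Literature.Barriers.CriticalPhenomena.NienhuisWeightsExcludeVertexSAW: applies to any proof of
QuadrupoleShape by an exact local linear relation on ℤ² (HasExactVertexRelationZ2 is empty,
not_hasExactVertexRelationZ2); NOT evaded by a lattice identity — the route posits none: the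
observable is a real occupation statistic, only ASYMPTOTICALLY covariant, and the bet is that its
shape follows from locality of the amplitude plus a covariance input obtained elsewhere (restriction
passed to subsequential limits + DRC's continuum argument, or a local-limit theorem à la BLV); the
cheapest falsifier tests the shape directly.
- Literature.Barriers.CriticalPhenomena.ParafermionicHalfCauchyRiemann: not engaged — no
parafermion, no spin-5/8 phase, no half Cauchy–Riemann system; the observable has integer spin 2
read through D4 representation theory.
- Literature.Barriers.CriticalPhenomena.SAWNoUnitaryCFT: consistent with and used by the line — no
Hilbert-space positivity is invoked; at c = 0 ⟨TT⟩ = 0 and T has a logarithmic partner (the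
barrier's evasions_known: log-CFT, b-number), which the cruxes flag explicitly (log δ in the
universal amplitude, 1/log convergence); only ONE-point functions of T in the presence of the two
boundary h-insertions are used, and these are non-zero (DRC Q₂ = h/w², h = 5/8 ≠ 0; at the other c =
0 point κ = 6, h = 0 and the observable would vanish — a built-in consistency check).
- Literature.Barrie

History (route lifecycle, newest last):
- 2026-08-26T04:22:06Z · DORMANT — reconciler: no traction for 8.3 d (last activity item-evidence-added at 2026-08-17T19:24:59Z); parked, not closed — `ledger route dormant route-CriticalPhenomen (operator:999:2304038)

sub-problem: SAWScalingLimit · status: dormant · opened planner-plancard-CriticalPhenomena-SAWScaling-97f5e94c-0 2026-08-15T12:18:05Z · rev 4 · ledger route-CriticalPhenomena-SAWStressTensor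
GENERATED by the gate from the ledger (D-0016/17). Provers cite these decls: `theorem foo : Summit.CriticalPhenomena.SAWScalingLimit.Theses.SAWStressTensor.<Decl> := …` in Summits/CriticalPhenomena/SAWScalingLimit/Theorems/<Name>.lean.
-/

namespace Summit.CriticalPhenomena.SAWScalingLimit.Theses.SAWStressTensor

open scoped BigOperators Topology Manifold Classical MeasureTheory ProbabilityTheory Matrix InnerProductSpace ComplexConjugate ContinuousMap
open Filter Set Function TopologicalSpace MeasureTheory

attribute [summit_statement] _root_.SAWScalingLimit

/-- item stmt-CriticalPhenomena-7750 · crux · rank 2 · open · by planner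
why it might fail: Conformal covariance of a spin-2 one-point function with no ℤ² lattice engine; the quadrupole couples to the c=0 log partner t=Φ_{2,1} (x=2 exactly), so D-dependent corrections decay only like 1/log(1/δ); a spin-2 two-leg operator with x<2, or a non-local amplitude, refutes it.
sources: DoyonRivaCardy2006, FriedrichWerner2003, BauerBernard2003, Cardy2013, GurarieLudwig2005, arXiv:1110.1327
[crux] (card K1, prefix-free headline) there are amplitudes A₁, A₂ : ℝ → ℝ depending only on the
mesh such that for every Dobrushin domain (Ω; a, b), endpoint approximation, interior point z₀ with
lattice points z_δ → z₀, and chordal uniformizer φ : ℍ → Ω (0 ↦ a, ∞ ↦ b; ψ = φ⁻¹):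
E_δ[X₁(z_δ)]/A₁(δ) → Re (ψ′(z₀)/ψ(z₀))² and E_δ[X₂(z_δ)]/A₂(δ) → Im (ψ′(z₀)/ψ(z₀))², X₁ =
straight-horizontal minus straight-vertical passage at z, X₂ = (NE or SW turn) minus (NW or SE turn)
at z; the shape is invariant under ψ ↦ λψ, so nothing is normalised and no exponent enters.
[difficulty: open-problem] -/
@[route_item "route-CriticalPhenomena-SAWStressTensor", crux]
def QuadrupoleShape : Prop :=
  ∃ A₁ A₂ : ℝ → ℝ, ∀ (D : Literature.Probability.RandomPlanarGeometry.DobrushinDomain) (a b z : ℝ → Literature.Probability.LatticeModels.Site 2) (z₀ : ℂ) (φ : Literature.Probability.RandomPlanarGeometry.ConformalEquiv UpperHalfPlane.upperHalfPlaneSet D.carrier), let X₁ : (δ : ℝ) → Literature.Probability.LatticeModels.Site 2 → Literature.Probability.RandomPlanarGeometry.SAW.DomainSAW D.carrier δ (a δ) (b δ) → ℝ := fun _ v γ => (if s(v - ![1, 0], v) ∈ γ.walk.edges ∧ s(v, v + ![1, 0]) ∈ γ.walk.edges then (1 : ℝ) else 0) - (if s(v - ![0, 1], v) ∈ γ.walk.edges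 ∧ s(v, v + ![0, 1]) ∈ γ.walk.edges then (1 : ℝ) else 0); let X₂ : (δ : ℝ) → Literature.Probability.LatticeModels.Site 2 → Literature.Probability.RandomPlanarGeometry.SAW.DomainSAW D.carrier δ (a δ) (b δ) → ℝ := fun _ v γ => (if (s(v, v + ![1, 0]) ∈ γ.walk.edges ∧ s(v, v + ![0, 1]) ∈ γ.walk.edges) ∨ (s(v - ![1, 0], v) ∈ γ.walk.edges ∧ s(v - ![0, 1], v) ∈ γ.walk.edges) then (1 : ℝ) else 0) - (if (s(v - ![1, 0], v) ∈ γ.walk.edges ∧ s(v, v + ![0, 1]) ∈ γ.walk.edges) ∨ (s(v, v + ![1, 0]) ∈ γ.walk.edges ∧ s(v - ![0, 1], v) ∈ γ.walk.edges) then (1 : ℝ) else 0); Literature.Probability.RandomPlanarGeometry.SAW.IsEndpointApprox D a b → D.IsChordalUniformizing φ → z₀ ∈ D.carrier → Filter.Tendsto (fun δ => Literature.Probability.LatticeModels.meshPoint δ (z δ)) (nhdsWithin 0 (Set.Ioi 0)) (nhds z₀) → Filter.Tendsto (fun δ => (∫ γ, X₁ δ (z δ) γ ∂(Literature.Probability.RandomPlanarGeometry.SAW.law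 D.carrier δ (a δ) (b δ))) / A₁ δ) (nhdsWithin 0 (Set.Ioi 0)) (nhds ((deriv φ.symm z₀) ^ 2 / (φ.symm z₀) ^ 2).re) ∧ Filter.Tendsto (fun δ => (∫ γ, X₂ δ (z δ) γ ∂(Literature.Probability.RandomPlanarGeometry.SAW.law D.carrier δ (a δ) (b δ))) / A₂ δ) (nhdsWithin 0 (Set.Ioi 0)) (nhds ((deriv φ.symm z₀) ^ 2 / (φ.symm z₀) ^ 2).im)

/-- item stmt-CriticalPhenomena-7751 · crux · rank 3 · open · by planner
why it might fail: Uniformity over ALL rough lattice slits with ONE amplitude is a local-limit statement beyond the scaling limit (proved only for LERW, BLV); an interior a_δ makes Ω_δ∖η doubly connected at scale dist(a_δ,∂Ω); lattice-scale necks cut by the past may leave O(1) gaps vanishing only in probability.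
sources: BenesLawlerViklund2015, KozdronLawler2005, KennedyLawler2013, DoyonRivaCardy2006, LawlerSchrammWerner2004SAW, DuminilCopinSmirnov2012Clay
[crux] (card K1, martingale-ready and lattice-intrinsic) there are A₁, A₂ : ℝ → ℝ such that for
every Dobrushin domain and endpoint approximation, every ε, ρ > 0 and all small δ: for EVERY
self-avoiding prefix η of positive SAW.law-probability from a_δ to a tip v and every site z that is
ρ-inside Ω and ρ-away from b_δ and from all vertices of η, |E[X₁(z) | γ extends η]/A₁(δ) − Re
S^δ_η(z)| ≤ ε and |E[X₂(z) | γ extends η]/A₂(δ) − Im S^δ_η(z)| ≤ ε, where S^δ_η(z) = (D_z L)², L(p)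
= log(G_η(p, b_δ)/G_η(p, v)), G_η the Green function of SRW on Ω_δ minus η∖{v} killed at its first
illegal step, and D_z L = [(L(z+e₁) − L(z−e₁)) − i(L(z+e₂) − L(z−e₂))]/(4δ) the discrete ∂_z: the
random-walk form of (ψ′_η/ψ_η)² for the slit domain (poles at the tip and at b; constants, local
lattice factors and the log-partner amplitude all cancel under ∂ log). η = nil recovers
QuadrupoleShape once the RW shape converges to the conformal one. [deps: QuadrupoleShape]
[difficulty: open-problem] -/
@[route_item "route-CriticalPhenomena-SAWStressTensor", crux]
def SlitQuadrupoleShape : Prop :=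
  ∃ A₁ A₂ : ℝ → ℝ, ∀ (D : Literature.Probability.RandomPlanarGeometry.DobrushinDomain) (a b : ℝ → Literature.Probability.LatticeModels.Site 2), Literature.Probability.RandomPlanarGeometry.SAW.IsEndpointApprox D a b → let X₁ : (δ : ℝ) → Literature.Probability.LatticeModels.Site 2 → Literature.Probability.RandomPlanarGeometry.SAW.DomainSAW D.carrier δ (a δ) (b δ) → ℝ := fun _ v γ => (if s(v - ![1, 0], v) ∈ γ.walk.edges ∧ s(v, v + ![1, 0]) ∈ γ.walk.edges then (1 : ℝ) else 0) - (if s(v - ![0, 1], v) ∈ γ.walk.edges ∧ s(v, v + ![0, 1]) ∈ γ.walk.edges then (1 : ℝ) else 0); let X₂ : (δ : ℝ) → Literature.Probability.LatticeModels.Site 2 → Literature.Probability.RandomPlanarGeometry.SAW.DomainSAW D.carrier δ (a δ) (b δ) → ℝ := fun _ v γ => (if (s(v, v + ![1, 0]) ∈ γ.walk.edges ∧ s(v, v + ![0, 1]) ∈ γ.walk.edges) ∨ (s(v - ![1, 0], v) ∈ γ.walk.edges ∧ s(v - ![0, 1], v) ∈ γ.walk.edges) then (1 : ℝ) else 0)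 - (if (s(v - ![1, 0], v) ∈ γ.walk.edges ∧ s(v, v + ![0, 1]) ∈ γ.walk.edges) ∨ (s(v, v + ![1, 0]) ∈ γ.walk.edges ∧ s(v - ![0, 1], v) ∈ γ.walk.edges) then (1 : ℝ) else 0); let Gf : SimpleGraph (Literature.Probability.LatticeModels.Site 2) → Literature.Probability.LatticeModels.Site 2 → Literature.Probability.LatticeModels.Site 2 → ℝ := fun Gr p q => ∑' n : ℕ, (Literature.Probability.LatticeModels.SRW.pathLaw 2).real {ω | (∀ j < n, Gr.Adj (p + Literature.Probability.LatticeModels.SRW.S ω j) (p + Literature.Probability.LatticeModels.SRW.S ω (j + 1))) ∧ p + Literature.Probability.LatticeModels.SRW.S ω n = q}; ∀ ε > (0 : ℝ), ∀ ρ > (0 : ℝ), ∀ᶠ δ in nhdsWithin 0 (Set.Ioi 0), ∀ (v : Literature.Probability.LatticeModels.Site 2) (η : (Literature.Probability.LatticeModels.discreteDomainGraph D.carrier δ).Walk (a δ) v), η.IsPath → 0 < (Literature.Probability.RandomPlanarGeometry.SAW.law D.carrier δ (a δ) (b δ)).real {γ | ∃ q : (Literature.Probability.LatticeModels.discreteDomainGraph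 D.carrier δ).Walk v (b δ), γ.walk = η.append q} → ∀ (z : Literature.Probability.LatticeModels.Site 2), ρ ≤ Metric.infDist (Literature.Probability.LatticeModels.meshPoint δ z) D.carrierᶜ → ρ ≤ dist (Literature.Probability.LatticeModels.meshPoint δ z) (Literature.Probability.LatticeModels.meshPoint δ (b δ)) → (∀ w ∈ η.support, ρ ≤ dist (Literature.Probability.LatticeModels.meshPoint δ z) (Literature.Probability.LatticeModels.meshPoint δ w)) → let G := Literature.Probability.LatticeModels.discreteDomainGraph D.carrier δ; let S : Set (Literature.Probability.LatticeModels.Site 2) := {w | w ∈ η.support ∧ w ≠ v}; let Gη : SimpleGraph (Literature.Probability.LatticeModels.Site 2) := SimpleGraph.fromRel (fun x y => G.Adj x y ∧ x ∉ S ∧ y ∉ S); let Xη : Set (Literature.Probability.RandomPlanarGeometry.SAW.DomainSAW D.carrier δ (a δ) (b δ)) := {γ | ∃ q : G.Walk v (b δ), γ.walk = η.append q}; let condQ₁ : ℝ := (∫ γ in Xη, X₁ δ z γ ∂(Literature.Probability.RandomPlanarGeometry.SAW.law D.carrier δ (a δ) (b δ))) / (Literature.Probability.RandomPlanarGeometry.SAW.law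 D.carrier δ (a δ) (b δ)).real Xη; let condQ₂ : ℝ := (∫ γ in Xη, X₂ δ z γ ∂(Literature.Probability.RandomPlanarGeometry.SAW.law D.carrier δ (a δ) (b δ))) / (Literature.Probability.RandomPlanarGeometry.SAW.law D.carrier δ (a δ) (b δ)).real Xη; let L : Literature.Probability.LatticeModels.Site 2 → ℝ := fun p => Real.log (Gf Gη p (b δ) / Gf Gη p v); let DL : ℂ := (((L (z + ![1, 0]) - L (z - ![1, 0]) : ℝ) : ℂ) - Complex.I * ((L (z + ![0, 1]) - L (z - ![0, 1]) : ℝ) : ℂ)) / (4 * δ); |condQ₁ / A₁ δ - (DL ^ 2).re| ≤ ε ∧ |condQ₂ / A₂ δ - (DL ^ 2).im| ≤ ε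

/-- item stmt-CriticalPhenomena-7752 · crux · rank 4 · open · by planner
why it might fail: E[X_z|γ[0,n]]/A(δ) is unbounded off the good event (A(δ)→0), so the passage needs stopping plus UNIFORM killed-RW Green-gradient convergence in rough slit domains (unvendored) and L³ tails of sup|W| from simplicity alone; an interior a_δ spoils the chordal picture near t=0.
sources: CDHKSCRAS2014, DuminilCopinSmirnov2012Clay, KemppainenSmirnov2017, KozdronLawler2005, LawlerSchrammWerner2004, BauerBernard2003
[crux] (card K3 + the passage) QuadrupoleIdentification = SlitQuadrupoleShape → SimpleSubseqLimits →
SubseqIdentification (the two decls after the first are INLINED verbatim — they are rendered later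
in the file; rfl-equal to the named form, checked in the planner sketch). Proof plan = the CDHKS
pipeline for THIS observable: (i) a subsequential limit μ carried by simple chords is
Loewner-parametrised through a chordal uniformizer φ with continuous driving process W, W^δ → W
along the SAW; (ii) the exact bounded lattice martingales n ↦ E[X_i(z) | γ[0,n]] (domain Markov of
x_c^|γ|), normalised by A_i(δ) and stopped when the walk comes ρ-close to z, plus
SlitQuadrupoleShape plus convergence of killed-RW Green-function log-gradients in slit domains
(KozdronLawler2005-type, uniform) make Re and Im of ψ′(z)² g_t′(ψz)²/(g_t(ψz) − W_t)² μ-martingales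
for every bulk z, hence (both channels!) the complex process itself; (iii) bulk z near b ⇒ w = ψ(z)
= iy-type far field: TMartingaleDriver (support) gives W_t and W_t² − (8/3)t martingales (needs
sup|W| ∈ L³, KemppainenSmirnov2017 Prop. 3.8-type tails); (iv) Lévy + the tree's PROVED
isSLELaw_of_isLocalMartingale_driving_of_lt_four (κ = 8/3 < 4 -/
@[route_item "route-CriticalPhenomena-SAWStressTensor", crux]
def QuadrupoleIdentification : Prop :=
  SlitQuadrupoleShape → (∀ (D : Literature.Probability.RandomPlanarGeometry.DobrushinDomain) (a b : ℝ → Literature.Probability.LatticeModels.Site 2), Literature.Probability.RandomPlanarGeometry.SAW.IsEndpointApprox D a b → ∀ (s : ℕ → ℝ) (μ : MeasureTheory.Measure (Literature.Probability.RandomPlanarGeometry.CurveClass ℂ)), Filter.Tendsto s Filter.atTop (nhdsWithin 0 (Set.Ioi 0)) → MeasureTheory.IsProbabilityMeasure μ → (∀ f : BoundedContinuousFunction (Literature.Probability.RandomPlanarGeometry.CurveClass ℂ) ℝ, Filter.Tendsto (fun n => ∫ γ, f γ.curve ∂(Literature.Probability.RandomPlanarGeometry.SAW.law D.carrier (s n)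 (a (s n)) (b (s n)))) Filter.atTop (nhds (∫ x, f x ∂μ))) → ∀ᵐ γ ∂μ, γ ∈ Literature.Probability.RandomPlanarGeometry.CurveClass.simple ∧ γ.range ∩ frontier D.carrier ⊆ {D.pt 0, D.pt 1}) → (∀ (D : Literature.Probability.RandomPlanarGeometry.DobrushinDomain) (a b : ℝ → Literature.Probability.LatticeModels.Site 2), Literature.Probability.RandomPlanarGeometry.SAW.IsEndpointApprox D a b → ∀ (s : ℕ → ℝ) (μ : MeasureTheory.Measure (Literature.Probability.RandomPlanarGeometry.CurveClass ℂ)), Filter.Tendsto s Filter.atTop (nhdsWithin 0 (Set.Ioi 0)) → MeasureTheory.IsProbabilityMeasure μ → (∀ f : BoundedContinuousFunction (Literature.Probability.RandomPlanarGeometry.CurveClass ℂ) ℝ, Filter.Tendsto (fun n => ∫ γ, f γ.curve ∂(Literature.Probability.RandomPlanarGeometry.SAW.law D.carrier (s n) (a (s n)) (b (s n)))) Filter.atTop (nhds (∫ x, f x ∂μ))) → Literature.Probability.RandomPlanarGeometry.IsSLELaw ((8 : NNReal) / 3) D μ)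

/-- item stmt-CriticalPhenomena-4514 · crux · rank 5 · SPLIT (gen 1) into SeqSlitAvoidance, LimitRangeArc + glue ArcSplitGlue · direct attempts still welcome (low priority) · by planner
why it might fail: Weak limits of simple polylines need not be simple: needs uniform no-macroscopic-self-touching and no-boundary-crawling bounds for the x_c-SAW under EVERY endpoint approximation (interior a_δ included); only sub-ballisticity is in print, LSW04 argue simplicity heuristically.
sources: LawlerSchrammWerner2004SAW, KennedyLawler2013, DuminilCopinHammond2013, stmt-CriticalPhenomena-4514
[crux] (card r4, regularity half; subsequential form of SAWConfRestriction.SimpleOfLimit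
stmt-CriticalPhenomena-0774, which asks it only for a FULL limit) for every Dobrushin domain,
endpoint approximation, mesh sequence s_n → 0+ and probability measure μ on CurveClass ℂ that is the
weak limit of the SAW laws along s_n: μ-a.e. curve is simple and meets ∂Ω only at a, b. This is what
makes subsequential limits Loewner-parametrisable for DrivingIdentification; it is implied by the
conjunct (SLE_{8/3} is a simple chord) and is the target of idea card
brownian-domination-simple-limits. [difficulty: open-problem] -/
@[route_item "route-CriticalPhenomena-SAWStressTensor", crux]
def SimpleSubseqLimits : Prop :=
  ∀ (D : Literature.Probability.RandomPlanarGeometry.DobrushinDomain) (a b : ℝ → Literature.Probability.LatticeModels.Site 2), Literature.Probability.RandomPlanarGeometry.SAW.IsEndpointApprox D a b → ∀ (s : ℕ → ℝ) (μ : MeasureTheory.Measure (Literature.Probability.RandomPlanarGeometry.CurveClass ℂ)), Filter.Tendsto s Filter.atTop (nhdsWithin 0 (Set.Ioi 0)) → MeasureTheory.IsProbabilityMeasure μ → (∀ f : BoundedContinuousFunction (Literature.Probability.RandomPlanarGeometry.CurveClass ℂ) ℝ, Filter.Tendsto (fun n => ∫ γ, f γ.curve ∂(Literature.Probability.RandomPlanarGeometry.SAW.law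 D.carrier (s n) (a (s n)) (b (s n)))) Filter.atTop (nhds (∫ x, f x ∂μ))) → ∀ᵐ γ ∂μ, γ ∈ Literature.Probability.RandomPlanarGeometry.CurveClass.simple ∧ γ.range ∩ frontier D.carrier ⊆ {D.pt 0, D.pt 1}

-- parent: SimpleSubseqLimits · child (gen 1)
/--     item stmt-CriticalPhenomena-18398 · crux · rank 501 · open
    parent: SimpleSubseqLimits · by operator
    why it might fail: It is the A-side made continuous along random, mesh-dependent slit domains with interior mesoscopic roots: no x_c-specific repulsion estimate, observable or RSW exists for ℤ² SAW; uniformity over wild admissible pasts may fail even if fixed-domain limits do.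
    sources: LawlerSchrammWerner2004SAW, LawlerSchrammWerner2003Restriction, KennedyLawler2013, ChelkakSmirnov2012, DuminilCopinSmirnov2012, KemppainenSmirnov2017
[crux, ORDER child of SimpleSubseqLimits — ARC split by crux strategist session B (BC2 redirect of
stmt-CriticalPhenomena-4514), 2026-08-17] SEQUENTIAL SLIT AVOIDANCE: for every Dobrushin domain and
endpoint approximation, every ADMISSIBLE limit past π (a curve from a whose range is a simple arc
meeting ∂D only at a, tip in the closed ball B̄(q,ρ)), guard R > ρ and θ > 0 there is ε > 0 such
that along EVERY sequence of meshes s_n → 0+ and lattice first-entrance prefixes ω_n : a_{s_n} → t_n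
into B̄(q,ρ) whose curve classes converge to the class of π, eventually law(prefix ∧ a later vertex
ε-close to the R-far past of π) ≤ θ · law(prefix) (conditional far-slit avoidance given the prefix,
cross-multiplied, junk-safe). VERBATIM the item stmt-CriticalPhenomena-18169 of route
SAWLoopFugacityFlow (same text; expected to dedup/attach) = the open input
`Transfer.SequentialSlitAvoidance` of the landed line slit-continuous-restriction
(Theorems/SAWLoopFugacityFlowSimpleSubseqLimitsTransferLocal.lean; read-back
`ArcSplitEC.seqSlitText_iff`, Iff.rfl). Not summit-implied (conditional), strictly stronger than
PastFutureAvoidance, strictly weaker than the LSW package; probed for mis-statement by l -/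
@[route_item "route-CriticalPhenomena-SAWStressTensor"]
def SeqSlitAvoidance : Prop :=
  (∀ (D : Literature.Probability.RandomPlanarGeometry.DobrushinDomain) (a b : ℝ → Literature.Probability.LatticeModels.Site 2), Literature.Probability.RandomPlanarGeometry.SAW.IsEndpointApprox D a b → ∀ (π : Literature.Probability.RandomPlanarGeometry.Curve ℂ) (q : ℂ) (ρ R : ℝ), 0 < ρ → ρ < R → ((π 1 ∈ Metric.closedBall q ρ) ∧ Set.range (fun u : unitInterval => π u) ⊆ closure D.carrier ∧ ∃ e : C(unitInterval, ℂ), Function.Injective e ∧ Set.range e = Set.range (fun u : unitInterval => π u) ∧ e 0 = D.pt 0 ∧ ∀ u : unitInterval, e u ∈ frontier D.carrier → u = 0) → ∀ θ : ℝ, 0 < θ → ∃ ε : ℝ, 0 < ε ∧ ∀ (s : ℕ → ℝ) (t : ℕ → Literature.Probability.LatticeModels.Site 2) (ω : ∀ n : ℕ, Literature.Probability.RandomPlanarGeometry.SAW.DomainSAW D.carrier (s n) (a (s n)) (t n)), Filter.Tendsto s Filter.atTop (nhdsWithin 0 (Set.Ioi 0)) → (∀ n : ℕ, Literature.Probability.LatticeModels.meshPoint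 (s n) (t n) ∈ Metric.closedBall q ρ) → (∀ n : ℕ, ∀ x ∈ (ω n).walk.support.dropLast, Literature.Probability.LatticeModels.meshPoint (s n) x ∉ Metric.closedBall q ρ) → Filter.Tendsto (fun n => (ω n).curve) Filter.atTop (nhds (Literature.Probability.RandomPlanarGeometry.CurveClass.mk π)) → ∀ᶠ n in Filter.atTop, Literature.Probability.RandomPlanarGeometry.SAW.law D.carrier (s n) (a (s n)) (b (s n)) {γ : Literature.Probability.RandomPlanarGeometry.SAW.DomainSAW D.carrier (s n) (a (s n)) (b (s n)) | γ.walk.support.take ((ω n).length + 1) = (ω n).walk.support ∧ ∃ j : ℕ, (ω n).length ≤ j ∧ j ≤ γ.length ∧ ∃ z ∈ ((fun u : unitInterval => π u) '' {u : unitInterval | ∀ u' : unitInterval, u' ≤ u → R < dist (π u') q}), dist (Literature.Probability.LatticeModels.meshPoint (s n) (γ.walk.getVert j)) z < ε} ≤ ENNReal.ofReal θ * Literature.Probability.RandomPlanarGeometry.SAW.law D.carrier (s n) (a (s n)) (b (s n)) {γ : Literature.Probability.RandomPlanarGeometry.SAW.DomainSAW D.carrier (s n) (a (s n)) (b (s n))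 | γ.walk.support.take ((ω n).length + 1) = (ω n).walk.support})

-- parent: SimpleSubseqLimits · child (gen 1)
/--     item stmt-CriticalPhenomena-18399 · crux · rank 502 · open
    parent: SimpleSubseqLimits · by operator
    why it might fail: Nothing on an observable route pins the SHAPE of subsequential limits before identification; conformal invariance + restriction give only a hull P_α of unknown exponent (α > 5/8 = SLE_κ + Brownian bubbles, not an arc), and no ℤ² estimate excludes beads/Z-folds.
    sources: LawlerSchrammWerner2003Restriction, LawlerSchrammWerner2004SAW, Kennedy2002, KennedyLawler2013, stmt-CriticalPhenomena-18170, stmt-CriticalPhenomena-10649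
[crux, SHAPE child of SimpleSubseqLimits — ARC split by crux strategist session B (BC2 redirect of
stmt-CriticalPhenomena-4514), 2026-08-17] LIMIT RANGE ARC (value-free, ORDER-BLIND): under every
subsequential weak limit ν of the pushed-forward critical SAW laws along s_n → 0+, ν-a.e. class has
the RANGE of a simple arc from a = D.pt 0 to b = D.pt 1 (an injective e : C([0,1], ℂ) with the same
range and endpoints) meeting ∂D only at a, b. Verbatim the line vocabulary
`PastShadowing.Main.RangeArc` (= `ArcSplitEC.LimitRangeArc`, read-back `rangeArcText_iff`, Iff.rfl;
identical to the child prepared for route SAWTensorRG by strategist s2, APPLY-SPLIT-tensorrg.md). It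
is a CONSEQUENCE of the parent (`ArcSplitEC.rangeArc_of_core`: a simple class has an injective
representative; endpoints ν-a.e. by `Negative.ae_source_target_range_of_weakLimitAlong`) and exactly
the part of the A-side the landed soft transfer uses (admissibility of limit pasts via SubArc;
boundary clause of the closing). On THIS observable route nothing route-native produces SHAPE (the
martingale observable identifies the law only after the subsequential limits are
Loewner-parametrised, which is what the parent is for); i -/
@[route_item "route-CriticalPhenomena-SAWStressTensor"]
def LimitRangeArc : Prop :=
  (∀ (D : Literature.Probability.RandomPlanarGeometry.DobrushinDomain) (a b : ℝ → Literature.Probability.LatticeModels.Site 2), Literature.Probability.RandomPlanarGeometry.SAW.IsEndpointApprox D a b → ∀ (s : ℕ → ℝ) (ν : MeasureTheory.Measure (Literature.Probability.RandomPlanarGeometry.CurveClass ℂ)), Filter.Tendsto s Filter.atTop (nhdsWithin 0 (Set.Ioi 0)) → MeasureTheory.IsProbabilityMeasure ν → (∀ f : BoundedContinuousFunction (Literature.Probability.RandomPlanarGeometry.CurveClass ℂ) ℝ, Filter.Tendsto (fun n => ∫ γ, f γ.curve ∂(Literature.Probability.RandomPlanarGeometry.SAW.law D.carrier (s n) (a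 (s n)) (b (s n)))) Filter.atTop (nhds (∫ x, f x ∂ν))) → ∀ᵐ γ ∂ν, (∃ e : C(unitInterval, ℂ), Function.Injective e ∧ Set.range e = γ.range ∧ e 0 = D.pt 0 ∧ e 1 = D.pt 1) ∧ γ.range ∩ frontier D.carrier ⊆ {D.pt 0, D.pt 1})

-- parent: SimpleSubseqLimits · glue (gen 1)
/--     item stmt-CriticalPhenomena-18400 · support · rank 503 · closed · proved by Summit.CriticalPhenomena.SAWScalingLimit.Theorems.SimpleSubseqLimits.SlitRestriction.ArcSplitEC.ArcSplitGlue_proof @ 8ff3cf212954 (operator)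
    parent: SimpleSubseqLimits · GLUE: children ⟹ parent · by operator
SeqSlitAvoidance → LimitRangeArc → SimpleSubseqLimits — PROVED and LANDED as
Summit.CriticalPhenomena.SAWScalingLimit.Theorems.SimpleSubseqLimits.SlitRestriction.ArcSplitEC.stressTensor_of_arcSubs
(Theorems/SAWStressTensorSimpleSubseqLimitsSplit.lean, p167904, commit e269985bf5ac; over the
children's route-file texts VERBATIM, read-backs seqSlitText_iff / rangeArcText_iff by Iff.rfl) on
top of the route-neutral ArcSplitEC.core_of_seqSlitAvoidance_rangeArc
(Theorems/SAWExcursionCardySimpleSubseqLimitsSplit.lean, p167883: lead c9's landed soft transfer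
p153873 + closing p154999 re-hosted on the value-free SHAPE hypothesis PastShadowing.Main.RangeArc).
--glue-by is impossible (glue.cyclic-import: a by-name glue module imports this Theses file), hence
this glue ITEM, closed at once by a 3-line Theorems file  (crux strategist r1, session B).
[difficulty: provable-now] -/
@[route_item "route-CriticalPhenomena-SAWStressTensor"]
def ArcSplitGlue : Prop :=
  SeqSlitAvoidance → LimitRangeArc → SimpleSubseqLimits

-- `ArcSplitGlue` holds: proved by `Summit.CriticalPhenomena.SAWScalingLimit.Theorems.SimpleSubseqLimits.SlitRestriction.ArcSplitEC.ArcSplitGlue_proof` @ 8ff3cf212954 (its module imports this route file, so no `_holds` link can be stated here).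

/-- item stmt-CriticalPhenomena-1881 · crux · rank 6 · open · by planner
why it might fail: Open for SAW: no RSW / annulus-crossing bound at x_c (KemppainenSmirnov2017 §4 covers FKG models only); the all-δ form stmt-CriticalPhenomena-0772 is refuted and only sub-ballisticity (DuminilCopinHammond2013) is unconditional.
sources: KemppainenSmirnov2017, DuminilCopinHammond2013, Summit.CriticalPhenomena.SAWScalingLimit.Theorems.SAWParafermionTight_refuted, stmt-CriticalPhenomena-1881
[support] EVENTUAL TIGHTNESS of the critical SAW laws: for every Dobrushin domain and endpoint
approximation, IsTightAlongMesh (fun δ γ => γ.curve) (fun δ => SAW.law D δ a_δ b_δ) — for every ε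
some compact set of CurveClass ℂ carries all but ε of the mass for all small δ. This is the form the
Prokhorov criterion convergesInLawToSLE_of_isTightAlongMesh consumes and the repair of the refuted
all-δ Tight (IsTightLaws over δ ∈ (0,1]) suggested by the refuting theorem; offered to routes
SAWParafermion / SAWConfRestriction as their restated r3/r4. -/
@[route_item "route-CriticalPhenomena-SAWStressTensor", crux]
def EventualTight : Prop :=
  ∀ (D : Literature.Probability.RandomPlanarGeometry.DobrushinDomain) (a b : ℝ → Literature.Probability.LatticeModels.Site 2), Literature.Probability.RandomPlanarGeometry.SAW.IsEndpointApprox D a b → Literature.Probability.RandomPlanarGeometry.IsTightAlongMesh (fun δ (γ : Literature.Probability.RandomPlanarGeometry.SAW.DomainSAW D.carrier δ (a δ) (b δ)) => γ.curve) (fun δ => Literature.Probability.RandomPlanarGeometry.SAW.law D.carrier δ (a δ) (b δ))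

/-- item stmt-CriticalPhenomena-0783 · support · rank 9 · open · by planner
sources: LawlerSchrammWerner2004SAW, LawlerSchrammWerner2003Restriction, stmt-CriticalPhenomena-0783
[crux] r3: identification of subsequential limits — for every Dobrushin domain D, endpoint
approximation (a_δ,b_δ), sequence s_n → 0+ and probability measure μ on CurveClass ℂ, if ∫ f∘curve
d(Literature.Probability.RandomPlanarGeometry.SAW.law D (s n) …) → ∫ f dμ for all bounded continuous
f then μ is the chordal SLE_{8/3} law in D (Literature.Probability.RandomPlanarGeometry.IsSLELaw
(8/3) D μ). Obtained from r2 (observable limit) by the martingale principle (LSW03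
arXiv:math/0209343 Prop. 5.2: κ = 8/3 is singled out by the 5/8-observable), or from restriction
(sibling route). -/
@[route_item "route-CriticalPhenomena-SAWStressTensor", crux]
def SubseqIdentification : Prop :=
  ∀ (D : Literature.Probability.RandomPlanarGeometry.DobrushinDomain) (a b : ℝ → Literature.Probability.LatticeModels.Site 2), Literature.Probability.RandomPlanarGeometry.SAW.IsEndpointApprox D a b → ∀ (s : ℕ → ℝ) (μ : MeasureTheory.Measure (Literature.Probability.RandomPlanarGeometry.CurveClass ℂ)), Filter.Tendsto s Filter.atTop (nhdsWithin 0 (Set.Ioi 0)) → MeasureTheory.IsProbabilityMeasure μ → (∀ f : BoundedContinuousFunction (Literature.Probability.RandomPlanarGeometry.CurveClass ℂ) ℝ, Filter.Tendsto (fun n => ∫ γ, f γ.curve ∂(Literature.Probability.RandomPlanarGeometry.SAW.law D.carrier (s n) (a (s n)) (b (s n)))) Filter.atTop (nhds (∫ x, f x ∂μ))) → Literature.Probability.RandomPlanarGeometry.IsSLELaw ((8 : NNReal) / 3) D μ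

/-- item stmt-CriticalPhenomena-7753 · support · rank 9 · closed · proved by Summit.CriticalPhenomena.SAWScalingLimit.Theorems.tMartingaleDriver_proof @ 657f3200cf4f (prover) · by planner
sources: Literature.Probability.RandomPlanarGeometry.Loewner.martingale_driver_of_fkObservable, Literature.Probability.RandomPlanarGeometry.Loewner.FarRegime.norm_spinDensity_sub_le, CDHKSCRAS2014, BauerBernard2003, FriedrichWerner2003
[support] (card K3, the KEY COMPUTATION made provable; continuum, no lattice) for a real process W
indexed by ℝ≥0 on a probability space, strongly adapted to a filtration 𝓕, with continuous paths,
W_0 = 0 and running supremum on each [0, t] dominated by some nonnegative M ∈ L³: if for all large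
levels y the real and imaginary parts of the stopped stress-tensor observable (iy ·
g_r′(iy)/(g_r(iy) − W_r))² of the chordal Loewner chain of the path (g = Loewner.map), evaluated at
the stopped clock r ∧ τ_y (τ_y = Loewner.farStopTime, the CDHKS far-field stopping time of the
tree), are 𝓕-martingales, then W_t and W_t² − (8/3)t are 𝓕-martingales. Proof =
Loewner.martingale_driver_of_fkObservable verbatim with the density expansion (z g′/(g − W))² = 1 +
2W/z + (3W² − 8t)/z² + O(α³) (multiply the tree's norm_spinDensity_sub_le by the expansion of g′):
Im gives W, Re gives 3W² − 8t. The amplitude-free identification: any constant multiple of the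
observable gives the same conclusion, and κ = 8/3 is forced with no exponent input. [difficulty:
provable-now] -/
@[route_item "route-CriticalPhenomena-SAWStressTensor", crux]
def TMartingaleDriver : Prop :=
  ∀ (Ω : Type) (mΩ : MeasurableSpace Ω) (P : MeasureTheory.Measure Ω) (𝓕 : MeasureTheory.Filtration NNReal mΩ) (W : NNReal → Ω → ℝ), MeasureTheory.IsProbabilityMeasure P → MeasureTheory.StronglyAdapted 𝓕 W → (∀ ω, Continuous (W · ω)) → (∀ ω, W 0 ω = 0) → (∀ t : NNReal, ∃ M : Ω → ℝ, MeasureTheory.MemLp M 3 P ∧ (∀ ω, 0 ≤ M ω) ∧ ∀ᵐ ω ∂P, ∀ u, u ≤ t → |W u ω| ≤ M ω) → ∀ y₀ : ℝ, let O : ℝ → NNReal → Ω → ℂ := fun y => MeasureTheory.stoppedProcess (fun r ω => (Complex.I * y * deriv (Literature.Probability.RandomPlanarGeometry.Loewner.map (fun u => W u ω) r) (Complex.I * y) / (Literature.Probability.RandomPlanarGeometry.Loewner.map (fun u => W u ω) r (Complex.I * y) - W r ω)) ^ 2) (Literature.Probability.RandomPlanarGeometry.Loewner.farStopTime W y); (∀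 y, y₀ ≤ y → MeasureTheory.Martingale (fun r ω => (O y r ω).re) 𝓕 P) → (∀ y, y₀ ≤ y → MeasureTheory.Martingale (fun r ω => (O y r ω).im) 𝓕 P) → MeasureTheory.Martingale W 𝓕 P ∧ MeasureTheory.Martingale (fun t ω => W t ω ^ 2 - 8 / 3 * (t : ℝ)) 𝓕 P

-- `TMartingaleDriver` holds: proved by `Summit.CriticalPhenomena.SAWScalingLimit.Theorems.tMartingaleDriver_proof` @ 657f3200cf4f (its module imports this route file, so no `_holds` link can be stated here).

/-- item stmt-CriticalPhenomena-7754 · assembly · rank 1 · closed · proved by Summit.CriticalPhenomena.SAWScalingLimit.Theorems.stressTensor_assembly_proof (prover) · by planner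
sources: Literature.Probability.RandomPlanarGeometry.convergesInLawToSLE_of_isTightAlongMesh, Literature.Probability.RandomPlanarGeometry.IsSLECurve.map_eq_holds, Literature.Probability.RandomPlanarGeometry.SAW.aemeasurable_curve
[assembly] QuadrupoleShape → SlitQuadrupoleShape → SimpleSubseqLimits → QuadrupoleIdentification →
EventualTight → SAWScalingLimit. -/
@[route_item "route-CriticalPhenomena-SAWStressTensor", crux]
def Assembly : Prop :=
  QuadrupoleShape → SlitQuadrupoleShape → SimpleSubseqLimits → QuadrupoleIdentification → EventualTight → SAWScalingLimit

-- `Assembly` holds: proved by `Summit.CriticalPhenomena.SAWScalingLimit.Theorems.stressTensor_assembly_proof` (its module imports this route file, so no `_holds` link can be stated here).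

/-! D-0027 §2.1 — DECIDING THEOREM (planner-authored via `route open/edit --closes-file`; by operator:999:1754322 2026-08-15T15:01:21Z):
its hypotheses are this route's items and its conclusion the sub-problem Statement (glue_lint), and it elaborates with this file. -/

@[closes "route-CriticalPhenomena-SAWStressTensor"] theorem closes : QuadrupoleShape → SlitQuadrupoleShape → QuadrupoleIdentification → SimpleSubseqLimits → EventualTight → SubseqIdentification → TMartingaleDriver → Assembly → _root_.SAWScalingLimit := fun h_QuadrupoleShape h_SlitQuadrupoleShape h_QuadrupoleIdentification h_SimpleSubseqLimits h_EventualTight h_SubseqIdentification h_TMartingaleDriver h_Assembly => h_Assembly h_QuadrupoleShape h_SlitQuadrupoleShape h_SimpleSubseqLimits h_QuadrupoleIdentification h_EventualTight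

end Summit.CriticalPhenomena.SAWScalingLimit.Theses.SAWStressTensor
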